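import Mathlib
import Literature.NumberTheory.LFunctions.Zhang2022.Section8Step8u016Tools
import Literature.NumberTheory.LFunctions.Zhang2022.Section8Ded81Prelims
import Literature.NumberTheory.LFunctions.Zhang2022.Section16Eval1617
import Literature.NumberTheory.LFunctions.Zhang2022.TypedSection01and02B
import Literature.NumberTheory.LFunctions.Zhang2022.Section18SjNormSizes
import HarnessLib

/-!
# Zhang (2022) §8 p. 43, step `Z22:§8.u016` DISCHARGED as an edge from Proposition 2.2 (i):
# "moving the segment `𝔍(α)` to `𝔍(1)` gives `Σ_{ψ∈Ψ₁} I₁⁺(𝐚₁,𝐚₂;ψ) = Θ₁(𝐚₁,𝐚₂) + O(ε)`"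

Topic `Literature/NumberTheory/LFunctions/Zhang2022` (Landau–Siegel audit tree; verdict-neutral;
D-0069 campaign node **Z22:§8.u016**, [Z22 p.43, proof of Lemma 8.1, tex L2255–L2258]; typed as
`Section8aStatements.Step8u016 c′`, consumed by `Skeleton.lemma81_of_steps` (cone leaf C19)).
Y. Zhang, *Discrete mean estimates and the Landau–Siegel zero*, arXiv:2211.02515v1 (2022)
[Zhang2022LandauSiegel] — **an unrefereed manuscript under adjudication**.

Main result: `step8u016_of : Skeleton.Prop22i → ∀ c′, Step8u016 c′` — with `ε`-exponent `c = 1/16`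
and constant `C = 1`: for all large `D`, all `𝐚₁, 𝐚₂` with (7.2),
`‖Σ_{ψ∈Ψ₁} I₁⁺ − Θ₁‖ ≤ exp(−𝓛¹⁰/16)`. The only manuscript input is Proposition 2.2 (i) (zeros of
`L(s,ψ)L(s,ψχ)`, `ψ ∈ Ψ₁`, in `Ω` lie on `σ = ½`), exactly the "By Proposition 2.2" of the proof of
Lemma 8.1 (p.42): it makes the integrand holomorphic on the rectangle and supplies the distance `≥ α`
from the zeros that the lower bound for `|L(s,ψ)|` on the horizontal sides needs
(`Literature/NumberTheory/LFunctions/DirichletLFunctionLowerBoundOffZeros.lean`). Steps: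

* sizes of the parameters for `𝓛 ≥ 3` (`alpha_small`, `window_sizes`, `chr_p_le_three_bigP`,
  `t0_le_bigP`, `frakP_le_eventually`, `omega_edge_le`, `log_factor_le`; reused from the tree:
  `Section2.alpha_eq_pi_div_ell9`, `Sec18SjNorm.Nsupp_le_two_mul_bigP`, `Skeleton.exists_forall_le_ell`);
* `norm_integrandC_le_uniform`: on both horizontal sides, uniformly in `ψ` and `u`,
  `|𝔠AĀω| ≤ K·B²·P¹²·e^{3C𝓛⁹(1+9log𝓛)}·e^{−𝓛¹⁰/4}` (from `Step8u016.norm_integrandC_le`);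
* Cauchy's theorem `Section7aStatements.norm_intJ_sub_intJ_le` per `ψ`, the sum over `#Ψ₁ ≤ 𝔓 ≤ 4P²`
  characters (`Ded81Edge.card_finsetOf_psiOne_le_frakP`), and the growth estimate `growth_le`
  (`(14+3C)𝓛⁹ + 27C𝓛⁹log𝓛 ≤ 𝓛¹⁰/8` once `√𝓛 ≥ 8(14+57C)`, via `log 𝓛 ≤ 2√𝓛`).

Theorems only; no definitions, no named facts. WHAT THIS IS NOT: any claim about Theorems 1–2 of the
manuscript or about Landau–Siegel zeros.

## References

* Y. Zhang, arXiv:2211.02515v1 (2022), §8 p.43 (proof of Lemma 8.1); §7 (7.1)–(7.4); §2.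
  [cite: Zhang2022LandauSiegel, §8 p.43, tex L2255–L2258]
-/

noncomputable section

open Complex Real Set Metric MeasureTheory
open Literature.NumberTheory.LFunctions.Zhang2022.Skeleton
open Literature.NumberTheory.LFunctions.Zhang2022.Section8aStatements

namespace Literature.NumberTheory.LFunctions.Zhang2022.Step8u016

/-! ## Sizes of the campaign parameters (`𝓛 = log D ≥ 3`) -/

section Sizes

variable {D : ℕ}

/-- For `𝓛 ≥ 3`: `0 < α ≤ 1/6` and `α ≤ 1`. [cite: Zhang2022LandauSiegel, §2 (2.10)] -/
theorem alpha_small (hℓ : 3 ≤ ell D) : 0 < alpha D ∧ alpha D ≤ 1 / 6 ∧ alpha D ≤ 1 := by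
  rw [Section2.alpha_eq_pi_div_ell9]
  have hℓ9 : (3 : ℝ) ^ 9 ≤ ell D ^ 9 := pow_le_pow_left₀ (by norm_num) hℓ 9
  have hπ := Real.pi_lt_four
  have h9 : 0 < ell D ^ 9 := by positivity
  refine ⟨by positivity, ?_, ?_⟩
  · rw [div_le_iff₀ h9]; nlinarith
  · rw [div_le_iff₀ h9]; nlinarith

/-- `|c′|·α𝓛 ≤ 1` once `π|c′| ≤ 𝓛⁸` (`α𝓛 = π𝓛⁻⁸`). [cite: Zhang2022LandauSiegel, §2 (2.13)] -/
theorem abs_c_mul_alpha_ell_le_one {c' : ℝ} (hℓ : 3 ≤ ell D) (hc : π * |c'| ≤ ell D ^ 8) :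
    |c'| * (alpha D * ell D) ≤ 1 := by
  have hℓ0 : 0 < ell D := by linarith
  have h8 : 0 < ell D ^ 8 := by positivity
  have hαℓ : alpha D * ell D = π / ell D ^ 8 := by
    rw [Section2.alpha_eq_pi_div_ell9]; field_simp
  rw [hαℓ, ← mul_div_assoc, div_le_one h8]
  linarith

/-- `𝓛₁ < 2πt₀`, `𝓛₁ ≤ t₀`, `1 ≤ t₀`, `1 ≤ 𝓛₂` for `𝓛 ≥ 3`. [cite: Zhang2022LandauSiegel, §2 (2.8)] -/
theorem window_sizes (hℓ : 3 ≤ ell D) :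
    ell1 D < 2 * π * t0 D ∧ ell1 D ≤ t0 D ∧ 1 ≤ t0 D ∧ 1 ≤ ell2 D ∧ 0 ≤ ell1 D := by
  have hℓ1 : 1 ≤ ell D := by linarith
  have h1 : ell D ^ 405 ≤ ell D ^ 519 := pow_le_pow_right₀ hℓ1 (by norm_num)
  have h405 : 1 ≤ ell D ^ 405 := one_le_pow₀ hℓ1
  rw [ell1, t0, ell2]
  refine ⟨?_, h1, one_le_pow₀ hℓ1, one_le_pow₀ hℓ1, by positivity⟩
  nlinarith [Real.pi_gt_three]

/-- Every modulus of the family is `< P(1 + 𝓛⁻⁶⁸) ≤ 3P`. [cite: Zhang2022LandauSiegel, §2 p.5 (`p ∼ P`)] -/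
theorem chr_p_le_three_bigP (hℓ : 3 ≤ ell D) (x : Chr D) : (x.p : ℝ) ≤ 3 * bigP D := by
  have hmem := x.mem
  simp only [primeWindow, Finset.mem_filter, Finset.mem_Ioo] at hmem
  have hlt : (x.p : ℝ) < bigP D * (1 + (ell D ^ 68)⁻¹) := Nat.lt_ceil.mp hmem.1.2
  have hP : 0 ≤ bigP D := (Real.exp_pos _).le
  have hinv : (ell D ^ 68)⁻¹ ≤ 1 := inv_le_one_of_one_le₀ (one_le_pow₀ (by linarith))
  nlinarith

/-- `t₀ = 𝓛⁵¹⁹ ≤ P = e^{𝓛⁹}` for `𝓛 ≥ 3` (`519 log 𝓛 ≤ 519𝓛 ≤ 𝓛⁹`). [cite: Zhang2022LandauSiegel, §2 (2.6), (2.8)] -/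
theorem t0_le_bigP (hℓ : 3 ≤ ell D) : t0 D ≤ bigP D := by
  have hℓ0 : 0 < ell D := by linarith
  rw [t0, bigP]
  have h1 : ell D ^ 519 = Real.exp (519 * Real.log (ell D)) := by
    rw [show (519 : ℝ) * Real.log (ell D) = Real.log (ell D ^ 519) by
      rw [Real.log_pow]; norm_num, Real.exp_log (pow_pos hℓ0 _)]
  rw [h1, Real.exp_le_exp]
  have hlog : Real.log (ell D) ≤ ell D := (Real.log_le_sub_one_of_pos hℓ0).trans (by linarith)
  have h8 : (3 : ℝ) ^ 8 ≤ ell D ^ 8 := pow_le_pow_left₀ (by norm_num) hℓ 8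
  nlinarith [pow_pos hℓ0 8]

/-- `𝔓 ≤ 4P²` for all large `D` ((2.9): `𝔓 = (1+O(𝓛⁻⁶⁸))P²𝓛⁻⁷⁷`). [cite: Zhang2022LandauSiegel, §2 (2.9)] -/
theorem frakP_le_eventually : ∃ D₀ : ℕ, ∀ D : ℕ, D₀ ≤ D → 1 ≤ ell D → frakP D ≤ 4 * bigP D ^ 2 := by
  obtain ⟨D₀, h⟩ := frakP_bounds
  refine ⟨D₀, fun D hD hℓ => ?_⟩
  have hb := h D hD
  have hP2 : Real.exp (Real.log D ^ 9) ^ 2 = bigP D ^ 2 := by rw [bigP, ell]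
  rw [hP2] at hb
  change |frakP D - bigP D ^ 2 * (ell D ^ 77)⁻¹| ≤ 3 * (ell D ^ 68)⁻¹ * (bigP D ^ 2 * (ell D ^ 77)⁻¹)
    at hb
  have h77 : (ell D ^ 77)⁻¹ ≤ 1 := inv_le_one_of_one_le₀ (one_le_pow₀ hℓ)
  have h68 : (ell D ^ 68)⁻¹ ≤ 1 := inv_le_one_of_one_le₀ (one_le_pow₀ hℓ)
  have hX : bigP D ^ 2 * (ell D ^ 77)⁻¹ ≤ bigP D ^ 2 :=
    (mul_le_mul_of_nonneg_left h77 (sq_nonneg _)).trans_eq (mul_one _)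
  have hX0 : 0 ≤ bigP D ^ 2 * (ell D ^ 77)⁻¹ := by
    exact mul_nonneg (sq_nonneg _) (inv_nonneg.mpr (pow_nonneg (by linarith) _))
  have h1 := (abs_le.mp hb).2
  nlinarith

/-- The Gaussian on the horizontal sides: for `𝓛 ≥ 3` and `(u−½)² ≤ 1`,
`(√π/𝓛₂)·exp(((u−½)² − 𝓛₁²)/(4𝓛₂²)) ≤ 6·e^{−𝓛¹⁰/4}` (`(𝓛₁/𝓛₂)² = 𝓛¹⁰`).
[cite: Zhang2022LandauSiegel, §2 (2.15), (7.4)] -/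
theorem omega_edge_le (hℓ : 3 ≤ ell D) {z : ℝ} (hz : z ^ 2 ≤ 1) :
    Real.sqrt π / ell2 D * Real.exp ((z ^ 2 - ell1 D ^ 2) / (4 * ell2 D ^ 2)) ≤
      6 * Real.exp (-(ell D ^ 10) / 4) := by
  have hℓ1 : 1 ≤ ell D := by linarith
  have hℓ2 : 1 ≤ ell2 D := by rw [ell2]; exact one_le_pow₀ hℓ1
  have hℓ20 : 0 < ell2 D := by linarith
  have hratio : ell1 D ^ 2 / (4 * ell2 D ^ 2) = ell D ^ 10 / 4 := by
    rw [div_eq_div_iff (by positivity) (by norm_num), ell1, ell2]; ring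
  have hexp : (z ^ 2 - ell1 D ^ 2) / (4 * ell2 D ^ 2) ≤ 1 + -(ell D ^ 10) / 4 := by
    rw [sub_div, hratio]
    have : z ^ 2 / (4 * ell2 D ^ 2) ≤ 1 := by
      rw [div_le_one (by positivity)]; nlinarith
    linarith
  have hsqrt : Real.sqrt π ≤ 2 := by
    rw [Real.sqrt_le_left (by norm_num)]; linarith [Real.pi_lt_four]
  have h1 : Real.sqrt π / ell2 D ≤ 2 := (div_le_self (Real.sqrt_nonneg _) hℓ2).trans hsqrt
  have h2 : Real.exp ((z ^ 2 - ell1 D ^ 2) / (4 * ell2 D ^ 2)) ≤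
      Real.exp 1 * Real.exp (-(ell D ^ 10) / 4) := by
    rw [← Real.exp_add]; exact Real.exp_le_exp.mpr hexp
  have he : Real.exp 1 ≤ 3 := by have := Real.exp_one_lt_d9; linarith
  have h3 := Real.exp_pos (-(ell D ^ 10) / 4)
  calc Real.sqrt π / ell2 D * Real.exp ((z ^ 2 - ell1 D ^ 2) / (4 * ell2 D ^ 2))
      ≤ 2 * (Real.exp 1 * Real.exp (-(ell D ^ 10) / 4)) :=
        mul_le_mul h1 h2 (Real.exp_pos _).le (by norm_num)
    _ ≤ 2 * (3 * Real.exp (-(ell D ^ 10) / 4)) := by gcongr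
    _ = 6 * Real.exp (-(ell D ^ 10) / 4) := by ring

/-- The logarithms on the sides: for `𝓛 ≥ 3`, `p ≤ 3P`, `1 ≤ t` with `|t| + 4 ≤ 12P`:
`(1 + log(1/α))(log p + log(|t|+4)) ≤ (1 + 9 log 𝓛)·3𝓛⁹`. [cite: Zhang2022LandauSiegel, §2 (2.6), (2.10)] -/
theorem log_factor_le (hℓ : 3 ≤ ell D) {p t : ℝ} (hp1 : 1 ≤ p) (hp : p ≤ 3 * bigP D)
    (ht4 : |t| + 4 ≤ 12 * bigP D) :
    (1 + Real.log (1 / alpha D)) * (Real.log p + Real.log (|t| + 4)) ≤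
      (1 + 9 * Real.log (ell D)) * (3 * ell D ^ 9) := by
  have hℓ0 : 0 < ell D := by linarith
  have hℓ1 : 1 ≤ ell D := by linarith
  have hlogℓ : 0 ≤ Real.log (ell D) := Real.log_nonneg hℓ1
  have hP : Real.log (bigP D) = ell D ^ 9 := by rw [bigP, Real.log_exp]
  have hP0 : 0 < bigP D := Real.exp_pos _
  have hℓ9 : (3 : ℝ) ^ 9 ≤ ell D ^ 9 := pow_le_pow_left₀ (by norm_num) hℓ 9
  -- `1 + log(1/α) = 1 + log(𝓛⁹/π) ≤ 1 + 9 log 𝓛`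
  have hα : 1 + Real.log (1 / alpha D) ≤ 1 + 9 * Real.log (ell D) := by
    rw [Section2.alpha_eq_pi_div_ell9, one_div, inv_div, Real.log_div (by positivity) Real.pi_pos.ne',
      Real.log_pow]
    push_cast
    linarith [Real.log_nonneg (show (1:ℝ) ≤ π by linarith [Real.pi_gt_three])]
  have hα0 : 0 ≤ 1 + Real.log (1 / alpha D) := by
    have : 1 ≤ 1 / alpha D := by
      rw [Section2.alpha_eq_pi_div_ell9, one_div, inv_div, le_div_iff₀ Real.pi_pos]
      nlinarith [Real.pi_lt_four]
    linarith [Real.log_nonneg this]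
  -- `log p ≤ log 3 + 𝓛⁹ ≤ 2 + 𝓛⁹`, `log(|t|+4) ≤ log 12 + 𝓛⁹ ≤ 3 + 𝓛⁹`
  have hlog3 : Real.log 3 ≤ 2 := by
    have : Real.log 3 ≤ Real.log (Real.exp 2) := Real.log_le_log (by norm_num) (by
      have := Real.add_one_le_exp (2:ℝ); linarith)
    rwa [Real.log_exp] at this
  have hlog12 : Real.log 12 ≤ 3 := by
    have : Real.log 12 ≤ Real.log (Real.exp 3) := Real.log_le_log (by norm_num) (by
      have h := Real.exp_one_gt_d9
      have h3 : Real.exp 3 = Real.exp 1 * Real.exp 1 * Real.exp 1 := by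
        rw [← Real.exp_add, ← Real.exp_add]; norm_num
      have h2 : (7 : ℝ) < Real.exp 1 * Real.exp 1 := by nlinarith
      rw [h3]; nlinarith)
    rwa [Real.log_exp] at this
  have hlp : Real.log p ≤ 2 + ell D ^ 9 := by
    calc Real.log p ≤ Real.log (3 * bigP D) := Real.log_le_log (by linarith) hp
      _ = Real.log 3 + ell D ^ 9 := by rw [Real.log_mul (by norm_num) hP0.ne', hP]
      _ ≤ 2 + ell D ^ 9 := by linarith
  have hlt : Real.log (|t| + 4) ≤ 3 + ell D ^ 9 := by
    calc Real.log (|t| + 4) ≤ Real.log (12 * bigP D) := Real.log_le_log (by positivity) ht4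
      _ = Real.log 12 + ell D ^ 9 := by rw [Real.log_mul (by norm_num) hP0.ne', hP]
      _ ≤ 3 + ell D ^ 9 := by linarith
  have hsum : Real.log p + Real.log (|t| + 4) ≤ 3 * ell D ^ 9 := by nlinarith
  have hsum0 : 0 ≤ Real.log p + Real.log (|t| + 4) :=
    add_nonneg (Real.log_nonneg hp1) (Real.log_nonneg (by linarith [abs_nonneg t]))
  calc (1 + Real.log (1 / alpha D)) * (Real.log p + Real.log (|t| + 4))
      ≤ (1 + 9 * Real.log (ell D)) * (Real.log p + Real.log (|t| + 4)) :=
        mul_le_mul_of_nonneg_right hα hsum0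
    _ ≤ (1 + 9 * Real.log (ell D)) * (3 * ell D ^ 9) :=
        mul_le_mul_of_nonneg_left hsum (by linarith)

/-- **The growth threshold**: for `A ≥ 0` and `L ≥ max(1, (8A)²)`, `A·L⁹·(1 + 2√L) ≤ … `; in the form used:
for `L ≥ 1` with `8(14 + 57C) ≤ √L`, `(14 + 3C)L⁹ + 27C·L⁹·log L ≤ L¹⁰/8` (`log L ≤ 2√L`).
[cite: Zhang2022LandauSiegel, §8 p.43 («O(ε)», `ε = e^{−c𝓛¹⁰}`)] -/
theorem growth_le {C L : ℝ} (hC : 0 ≤ C) (hL : 1 ≤ L) (hA : 8 * (14 + 57 * C) ≤ Real.sqrt L) :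
    (14 + 3 * C) * L ^ 9 + 27 * C * L ^ 9 * Real.log L ≤ L ^ 10 / 8 := by
  have hL0 : 0 < L := by linarith
  have hsq : Real.sqrt L * Real.sqrt L = L := Real.mul_self_sqrt hL0.le
  have hs1 : 1 ≤ Real.sqrt L := by rw [← Real.sqrt_one]; exact Real.sqrt_le_sqrt hL
  have hlog : Real.log L ≤ 2 * Real.sqrt L := by
    have h := Real.log_le_rpow_div hL0.le (show (0:ℝ) < 1/2 by norm_num)
    rw [← Real.sqrt_eq_rpow] at h
    linarith
  have h9 : 0 < L ^ 9 := pow_pos hL0 9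
  -- `(14+3C)L⁹ + 27C L⁹ log L ≤ (14 + 3C + 54C) L⁹ √L`
  have h1 : (14 + 3 * C) * L ^ 9 + 27 * C * L ^ 9 * Real.log L ≤
      (14 + 57 * C) * (L ^ 9 * Real.sqrt L) := by
    have e1 : (14 + 3 * C) * L ^ 9 ≤ (14 + 3 * C) * (L ^ 9 * Real.sqrt L) := by
      apply mul_le_mul_of_nonneg_left _ (by linarith)
      nlinarith
    have e2 : 27 * C * L ^ 9 * Real.log L ≤ 54 * C * (L ^ 9 * Real.sqrt L) := by
      have : 27 * C * L ^ 9 * Real.log L ≤ 27 * C * L ^ 9 * (2 * Real.sqrt L) :=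
        mul_le_mul_of_nonneg_left hlog (by positivity)
      linarith
    nlinarith
  -- `(14+57C) L⁹ √L ≤ L¹⁰/8` from `8(14+57C) ≤ √L`
  have h2 : (14 + 57 * C) * (L ^ 9 * Real.sqrt L) ≤ L ^ 10 / 8 := by
    have : 8 * (14 + 57 * C) * (L ^ 9 * Real.sqrt L) ≤ Real.sqrt L * (L ^ 9 * Real.sqrt L) :=
      mul_le_mul_of_nonneg_right hA (by positivity)
    have e : Real.sqrt L * (L ^ 9 * Real.sqrt L) = L ^ 10 := by
      calc Real.sqrt L * (L ^ 9 * Real.sqrt L) = (Real.sqrt L * Real.sqrt L) * L ^ 9 := by ring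
        _ = L ^ 10 := by rw [hsq]; ring
    rw [e] at this
    linarith
  exact h1.trans h2

end Sizes

/-! ## The uniform bound on the horizontal sides and the move `𝔍(α) → 𝔍(1)` -/

section Assembly

variable (c' : ℝ) {D : ℕ} [NeZero D] {χ : DirichletCharacter ℂ D}

/-- **The integrand on either horizontal side, uniformly in `ψ` and `u`**: with the hypotheses of
`norm_integrandC_le` and `𝓛 ≥ 3`, on `s = u + i(2πt₀ ± 𝓛₁)`, `½+α ≤ u ≤ 3/2`,
`|𝔠AĀω| ≤ K·B²·P¹²·exp(3C𝓛⁹(1 + 9log𝓛))·e^{−𝓛¹⁰/4}`, `K = 3e³·(39Z)³·16·6`.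
[cite: Zhang2022LandauSiegel, §8 p.43, tex L2255–L2258] -/
theorem norm_integrandC_le_uniform {C : ℝ} (hC0 : 0 < C)
    (hC : ∀ (q : ℕ) [NeZero q] (θ : DirichletCharacter ℂ q), θ ≠ 1 → ∀ t σ d : ℝ,
      1 / 2 ≤ σ → σ ≤ 2 → 0 < d → d ≤ 1 →
        (∀ ρ ∈ DirichletDisc.discZeros θ t, ∀ y ∈ Icc σ 2, d ≤ ‖(y : ℂ) + t * I - ρ‖) →
          Real.exp (-(C * (1 + Real.log (1 / d)) * (Real.log q + Real.log (|t| + 4)))) ≤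
            ‖θ.LFunction ((σ : ℂ) + t * I)‖)
    (x : Chr D) (h22 : ∀ s ∈ prodZeroSetOmega χ x, s.re = 1 / 2) (hD : 3 ≤ D) (hℓ : 3 ≤ ell D)
    (hc : π * |c'| ≤ ell D ^ 8) {B : ℝ} {a₁ a₂ : ℕ → ℂ} (ha₁ : Adm72 D B a₁) (ha₂ : Adm72 D B a₂)
    {u : ℝ} (hu1 : 1 / 2 + alpha D ≤ u) (hu2 : u ≤ 1 / 2 + 1) {t : ℝ}
    (ht : t = 2 * π * t0 D + ell1 D ∨ t = 2 * π * t0 D - ell1 D) :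
    ‖integrandC c' x a₁ a₂ ((u : ℂ) + t * I)‖ ≤
      (3 * Real.exp 3 * (39 * DirichletDisc.Zc) ^ 3 * 16 * 6) * B ^ 2 * bigP D ^ 12 *
        Real.exp (3 * C * ell D ^ 9 * (1 + 9 * Real.log (ell D))) *
        Real.exp (-(ell D ^ 10) / 4) := by
  obtain ⟨hα0, hα6, hα1⟩ := alpha_small hℓ
  obtain ⟨hwin, hℓ1t0, ht01, hℓ21, hℓ10⟩ := window_sizes hℓ
  have hcα := abs_c_mul_alpha_ell_le_one hℓ hc
  have hπ3 := Real.pi_gt_three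
  have hπ4 := Real.pi_lt_four
  have hπt : π * t0 D ≤ 7 / 2 * t0 D :=
    mul_le_mul_of_nonneg_right (by linarith [Real.pi_lt_d2]) (by linarith)
  have hπt' : 3 * t0 D ≤ π * t0 D := mul_le_mul_of_nonneg_right hπ3.le (by linarith)
  have htabs : |t - 2 * π * t0 D| ≤ ell1 D := by
    rcases ht with ht' | ht'
    · rw [ht', show 2 * π * t0 D + ell1 D - 2 * π * t0 D = ell1 D by ring, abs_of_nonneg hℓ10]
    · rw [ht', show 2 * π * t0 D - ell1 D - 2 * π * t0 D = -ell1 D by ring, abs_neg,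
        abs_of_nonneg hℓ10]
  have ht1 : 1 ≤ t := by rcases ht with ht' | ht' <;> rw [ht'] <;> linarith
  have htle : |t| ≤ 8 * t0 D := by
    rw [abs_of_pos (by linarith)]
    rcases ht with ht' | ht' <;> rw [ht'] <;> linarith
  -- sizes
  have hP0 : 0 < bigP D := Real.exp_pos _
  have hP1 : 1 ≤ bigP D := Real.one_le_exp (pow_nonneg (Real.log_natCast_nonneg D) 9)
  have hp3 := chr_p_le_three_bigP hℓ x
  have hp1 : (1 : ℝ) ≤ x.p := by exact_mod_cast x.prime.one_lt.le
  have ht0P := t0_le_bigP hℓ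
  have hN := Sec18SjNorm.Nsupp_le_two_mul_bigP D
  have hN0 : (0 : ℝ) ≤ Nsupp D := Nat.cast_nonneg _
  have hZ1 : 1 ≤ DirichletDisc.Zc := DirichletDisc.one_le_Zc
  have hB : 0 ≤ B := (norm_nonneg _).trans (ha₁.1 0)
  have ht4 : |t| + 4 ≤ 12 * bigP D := by nlinarith
  -- factor 1: `e³ p t₀ ≤ e³·3P·P`
  have f1 : Real.exp 3 * ((x.p : ℝ) * t0 D) ≤ Real.exp 3 * (3 * bigP D * bigP D) := by
    apply mul_le_mul_of_nonneg_left _ (Real.exp_pos 3).le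
    exact mul_le_mul hp3 ht0P (by linarith) (by linarith)
  -- factor 2: `(p(|t|+5)Z)³ ≤ (3P·13P·Z)³`
  have f2 : ((x.p : ℝ) * (|t| + 5) * DirichletDisc.Zc) ^ 3 ≤
      (3 * bigP D * (13 * bigP D) * DirichletDisc.Zc) ^ 3 := by
    apply pow_le_pow_left₀ (by positivity)
    apply mul_le_mul_of_nonneg_right _ (by linarith)
    exact mul_le_mul hp3 (by nlinarith) (by positivity) (by linarith)
  -- factor 3: the exponent
  have f3 : Real.exp (C * (1 + Real.log (1 / alpha D)) * (Real.log x.p + Real.log (|t| + 4))) ≤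
      Real.exp (3 * C * ell D ^ 9 * (1 + 9 * Real.log (ell D))) := by
    rw [Real.exp_le_exp, mul_assoc]
    have h := log_factor_le hℓ hp1 hp3 ht4
    calc C * ((1 + Real.log (1 / alpha D)) * (Real.log x.p + Real.log (|t| + 4)))
        ≤ C * ((1 + 9 * Real.log (ell D)) * (3 * ell D ^ 9)) := mul_le_mul_of_nonneg_left h hC0.le
      _ = 3 * C * ell D ^ 9 * (1 + 9 * Real.log (ell D)) := by ring
  -- factor 4: `(BN²)² ≤ (B·4P²)²`
  have f4 : (B * (Nsupp D : ℝ) ^ 2) ^ 2 ≤ (B * (4 * bigP D ^ 2)) ^ 2 := by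
    apply pow_le_pow_left₀ (by positivity)
    apply mul_le_mul_of_nonneg_left _ hB
    nlinarith
  -- factor 5: the Gaussian
  have f5 : Real.sqrt π / ell2 D * Real.exp (((u - 1 / 2) ^ 2 - (t - 2 * π * t0 D) ^ 2) /
      (4 * ell2 D ^ 2)) ≤ 6 * Real.exp (-(ell D ^ 10) / 4) := by
    have hsq : (t - 2 * π * t0 D) ^ 2 = ell1 D ^ 2 := by
      rcases ht with ht' | ht' <;> rw [ht'] <;> ring
    rw [hsq]
    exact omega_edge_le hℓ (pow_le_one₀ (by linarith) (by linarith))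
  -- combine
  have hbase := norm_integrandC_le c' x hC h22 hD hα0 hα6 hcα ha₁ ha₂ hu1 (by linarith) htabs ht1
  refine hbase.trans ?_
  have h0f1 : 0 ≤ Real.exp 3 * ((x.p : ℝ) * t0 D) := by positivity
  have h0f2 : 0 ≤ ((x.p : ℝ) * (|t| + 5) * DirichletDisc.Zc) ^ 3 := by positivity
  have h0f3 : 0 ≤ Real.exp (C * (1 + Real.log (1 / alpha D)) * (Real.log x.p + Real.log (|t| + 4))) :=
    (Real.exp_pos _).le
  have h0f4 : 0 ≤ (B * (Nsupp D : ℝ) ^ 2) ^ 2 := sq_nonneg _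
  have h0g5 : 0 ≤ 6 * Real.exp (-(ell D ^ 10) / 4) := by positivity
  calc Real.exp 3 * ((x.p : ℝ) * t0 D) * ((x.p : ℝ) * (|t| + 5) * DirichletDisc.Zc) ^ 3 *
        Real.exp (C * (1 + Real.log (1 / alpha D)) * (Real.log x.p + Real.log (|t| + 4))) *
        (B * (Nsupp D : ℝ) ^ 2) ^ 2 *
        (Real.sqrt π / ell2 D *
          Real.exp (((u - 1 / 2) ^ 2 - (t - 2 * π * t0 D) ^ 2) / (4 * ell2 D ^ 2)))
      ≤ Real.exp 3 * (3 * bigP D * bigP D) * (3 * bigP D * (13 * bigP D) * DirichletDisc.Zc) ^ 3 *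
        Real.exp (3 * C * ell D ^ 9 * (1 + 9 * Real.log (ell D))) *
        (B * (4 * bigP D ^ 2)) ^ 2 * (6 * Real.exp (-(ell D ^ 10) / 4)) := by
        have g1 := mul_le_mul f1 f2 h0f2 (by positivity)
        have g2 := mul_le_mul g1 f3 h0f3 (by positivity)
        have g3 := mul_le_mul g2 f4 h0f4 (by positivity)
        exact mul_le_mul g3 f5 (by
          exact mul_nonneg (div_nonneg (Real.sqrt_nonneg _) (by linarith)) (Real.exp_pos _).le)
          (by positivity)
    _ = (3 * Real.exp 3 * (39 * DirichletDisc.Zc) ^ 3 * 16 * 6) * B ^ 2 * bigP D ^ 12 *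
        Real.exp (3 * C * ell D ^ 9 * (1 + 9 * Real.log (ell D))) *
        Real.exp (-(ell D ^ 10) / 4) := by ring

omit [NeZero D] in
/-- `(1/2πi)∫_{𝔍(z)} F` in terms of the tree's `intJ = ∫_{𝔍(z)} F ds`.
[cite: Zhang2022LandauSiegel, §7 p.33 (`𝔍(z)`)] -/
theorem segInt_eq_intJ_div (z : ℝ) (F : ℂ → ℂ) :
    Lemma81.segInt (t0 D) (ell1 D) (z : ℂ) F = Section7aStatements.intJ D z F / (2 * π * I) := by
  have h2 : (2 : ℂ) * π * I ≠ 0 := by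
    have hπ : (π : ℂ) ≠ 0 := by exact_mod_cast Real.pi_ne_zero
    simp [hπ, Complex.I_ne_zero]
  rw [Section7aStatements.intJ, eq_div_iff h2]; ring

/-- **`Z22:§8.u016` as an edge from Proposition 2.2 (i)**: if for `ψ ∈ Ψ₁` the zeros of
`L(s,ψ)L(s,ψχ)` in `Ω` lie on the critical line (`Skeleton.Prop22i`), then for every `c′`
"moving the segment `𝔍(α)` to `𝔍(1)` gives `Σ_{ψ∈Ψ₁} I₁⁺(𝐚₁,𝐚₂;ψ) = Θ₁(𝐚₁,𝐚₂) + O(ε)`":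
`‖Σ_{ψ∈Ψ₁} I₁⁺ − Θ₁‖ ≤ 1·exp(−𝓛¹⁰/16)` for all large `D` and all `𝐚₁, 𝐚₂` with (7.2). Per `ψ`,
Cauchy's theorem on `[½+α, 3/2]×[2πt₀−𝓛₁, 2πt₀+𝓛₁]` (`Section7aStatements.norm_intJ_sub_intJ_le`,
holomorphy `differentiableOn_integrandC`) leaves the two horizontal sides, each
`≤ K B²P¹²e^{3C𝓛⁹(1+9log𝓛)}e^{−𝓛¹⁰/4}` pointwise (`norm_integrandC_le_uniform`); summing over
`#Ψ₁ ≤ 𝔓 ≤ 4P²` characters and absorbing `P¹⁴ = e^{14𝓛⁹}`, `e^{O(𝓛⁹log𝓛)}` and the constants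
into `e^{3𝓛¹⁰/16}` (`growth_le`) gives `e^{−𝓛¹⁰/16}`. [cite: Zhang2022LandauSiegel, §8 p.43, tex L2255–L2258] -/
theorem step8u016_of (h22 : Prop22i) (c' : ℝ) : Step8u016 c' := by
  classical
  intro B
  obtain ⟨C, hC0, hC⟩ := DirichletDisc.exp_neg_le_norm_LFunction
  obtain ⟨D₁, h22'⟩ := h22
  obtain ⟨D₂, hfrakP⟩ := frakP_le_eventually
  -- the growth threshold on `𝓛`
  set K : ℝ := 3 * Real.exp 3 * (39 * DirichletDisc.Zc) ^ 3 * 16 * 6 with hK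
  have hK0 : 0 < K := by rw [hK]; have := DirichletDisc.one_le_Zc; positivity
  obtain ⟨D₃, hD₃f⟩ := Skeleton.exists_forall_le_ell
    (max 3 (max (π * |c'| + 1) (max (64 * (4 * K * B ^ 2) + 1) ((8 * (14 + 57 * C)) ^ 2))))
  refine ⟨1 / 16, by norm_num, 1, max (max D₁ D₂) (max D₃ 3), fun D _ χ hD hq hp hA a₁ a₂ ha₁ ha₂ => ?_⟩
  have hD₁ : D₁ ≤ D := le_trans (le_trans (le_max_left _ _) (le_max_left _ _)) hD
  have hD₂ : D₂ ≤ D := le_trans (le_trans (le_max_right _ _) (le_max_left _ _)) hD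
  have hD₃ : D₃ ≤ D := le_trans (le_trans (le_max_left _ _) (le_max_right _ _)) hD
  have hD3 : 3 ≤ D := le_trans (le_trans (le_max_right _ _) (le_max_right _ _)) hD
  have hM := hD₃f D hD₃
  have hℓ3 : 3 ≤ ell D := le_trans (le_max_left _ _) hM
  have hℓc : π * |c'| + 1 ≤ ell D := le_trans (le_trans (le_max_left _ _) (le_max_right _ _)) hM
  have hℓK : 64 * (4 * K * B ^ 2) + 1 ≤ ell D :=
    le_trans (le_trans (le_trans (le_max_left _ _) (le_max_right _ _)) (le_max_right _ _)) hM
  have hℓA : (8 * (14 + 57 * C)) ^ 2 ≤ ell D :=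
    le_trans (le_trans (le_trans (le_max_right _ _) (le_max_right _ _)) (le_max_right _ _)) hM
  have hℓ1 : 1 ≤ ell D := by linarith
  have hℓ0 : 0 < ell D := by linarith
  have h22D := h22' D χ hD₁ hq hp
  obtain ⟨hα0, hα6, hα1⟩ := alpha_small hℓ3
  obtain ⟨hwin, -, -, -, hℓ10⟩ := window_sizes hℓ3
  have hc8 : π * |c'| ≤ ell D ^ 8 := by
    have : ell D ≤ ell D ^ 8 := by
      calc ell D = ell D ^ 1 := (pow_one _).symm
        _ ≤ ell D ^ 8 := pow_le_pow_right₀ hℓ1 (by norm_num)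
    linarith
  -- the uniform side bound `Mval`
  set Mval : ℝ := K * B ^ 2 * bigP D ^ 12 * Real.exp (3 * C * ell D ^ 9 * (1 + 9 * Real.log (ell D))) *
    Real.exp (-(ell D ^ 10) / 4) with hMval
  have hMval0 : 0 ≤ Mval := by rw [hMval]; positivity
  -- per character: `‖I₁⁺ − (1/2πi)∫_{𝔍(1)}‖ ≤ Mval`
  have hper : ∀ x ∈ finsetOf (PsiOne χ),
      ‖IonePlus c' x a₁ a₂ - Lemma81.segInt (t0 D) (ell1 D) 1 (integrandC c' x a₁ a₂)‖ ≤ Mval := by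
    intro x hx
    have hx' : x ∈ PsiOne χ := mem_of_mem_finsetOf hx
    have h22x : ∀ s ∈ prodZeroSetOmega χ x, s.re = 1 / 2 := h22D x hx'
    have hF := differentiableOn_integrandC c' x h22x hα0 hα1 hwin a₁ a₂
    have hside : ∀ t : ℝ, (t = 2 * π * t0 D + ell1 D ∨ t = 2 * π * t0 D - ell1 D) →
        ∀ u ∈ Set.Icc (1 / 2 + alpha D) (1 / 2 + 1),
          ‖integrandC c' x a₁ a₂ ((u : ℂ) + ((t : ℝ) : ℂ) * I)‖ ≤ Mval := by
      intro t ht u hu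
      have h := norm_integrandC_le_uniform c' hC0 hC x h22x hD3 hℓ3 hc8 ha₁ ha₂ hu.1 hu.2 ht
      rw [hMval, hK]; exact h
    have hmove := Section7aStatements.norm_intJ_sub_intJ_le D (z₁ := alpha D) (z₂ := 1)
      (M₁ := Mval) (M₂ := Mval) hα1 hF (hside _ (Or.inl rfl)) (hside _ (Or.inr rfl))
    -- `I₁⁺ − segInt 1 = (intJ α − intJ 1)/(2πi)`
    have hI : IonePlus c' x a₁ a₂ - Lemma81.segInt (t0 D) (ell1 D) 1 (integrandC c' x a₁ a₂) =
        (Section7aStatements.intJ D (alpha D) (integrandC c' x a₁ a₂) -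
          Section7aStatements.intJ D 1 (integrandC c' x a₁ a₂)) / (2 * π * I) := by
      rw [show IonePlus c' x a₁ a₂ = Lemma81.segInt (t0 D) (ell1 D) ((alpha D : ℝ) : ℂ)
        (integrandC c' x a₁ a₂) from rfl, show (1 : ℂ) = ((1 : ℝ) : ℂ) by norm_num,
        segInt_eq_intJ_div, segInt_eq_intJ_div, sub_div]
    have hnorm2 : ‖(2 : ℂ) * π * I‖ = 2 * π := by
      rw [norm_mul, norm_mul, Complex.norm_I, mul_one, Complex.norm_real, Real.norm_eq_abs,
        abs_of_pos Real.pi_pos]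
      norm_num
    rw [hI, norm_div, hnorm2, ← norm_neg, neg_sub]
    rw [div_le_iff₀ (by positivity)]
    calc ‖Section7aStatements.intJ D 1 (integrandC c' x a₁ a₂) -
          Section7aStatements.intJ D (alpha D) (integrandC c' x a₁ a₂)‖
        ≤ (1 - alpha D) * (Mval + Mval) := hmove
      _ ≤ 1 * (Mval + Mval) := by gcongr; linarith
      _ ≤ Mval * (2 * π) := by nlinarith [Real.pi_gt_three]
  -- summing over `Ψ₁`
  have hsum : ‖(∑ x ∈ finsetOf (PsiOne χ), IonePlus c' x a₁ a₂) - Theta1 c' χ a₁ a₂‖ ≤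
      (finsetOf (PsiOne χ)).card * Mval := by
    rw [Theta1_eq_sum_segInt, ← Finset.sum_sub_distrib]
    calc ‖∑ x ∈ finsetOf (PsiOne χ),
          (IonePlus c' x a₁ a₂ - Lemma81.segInt (t0 D) (ell1 D) 1 (integrandC c' x a₁ a₂))‖
        ≤ ∑ x ∈ finsetOf (PsiOne χ),
          ‖IonePlus c' x a₁ a₂ - Lemma81.segInt (t0 D) (ell1 D) 1 (integrandC c' x a₁ a₂)‖ :=
          norm_sum_le _ _
      _ ≤ ∑ x ∈ finsetOf (PsiOne χ), Mval := Finset.sum_le_sum hper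
      _ = (finsetOf (PsiOne χ)).card * Mval := by rw [Finset.sum_const, nsmul_eq_mul]
  have hcard : ((finsetOf (PsiOne χ)).card : ℝ) ≤ 4 * bigP D ^ 2 :=
    (Ded81Edge.card_finsetOf_psiOne_le_frakP χ).trans (hfrakP D hD₂ hℓ1)
  refine hsum.trans ((mul_le_mul_of_nonneg_right hcard hMval0).trans ?_)
  -- the final size estimate: `4P²·Mval ≤ e^{−𝓛¹⁰/16}`
  have hP : bigP D = Real.exp (ell D ^ 9) := rfl
  have hgrowth := growth_le hC0.le hℓ1 (by
    calc 8 * (14 + 57 * C) = Real.sqrt ((8 * (14 + 57 * C)) ^ 2) := by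
          rw [Real.sqrt_sq (by positivity)]
      _ ≤ Real.sqrt (ell D) := Real.sqrt_le_sqrt hℓA)
  -- `4KB² ≤ e^{𝓛¹⁰/16}`
  have hconst : 4 * K * B ^ 2 ≤ Real.exp (ell D ^ 10 / 16) := by
    have h2 : ell D ≤ ell D ^ 10 := by
      calc ell D = ell D ^ 1 := (pow_one _).symm
        _ ≤ ell D ^ 10 := pow_le_pow_right₀ hℓ1 (by norm_num)
    calc 4 * K * B ^ 2 ≤ ell D ^ 10 / 16 := by linarith
      _ ≤ ell D ^ 10 / 16 + 1 := by linarith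
      _ ≤ Real.exp (ell D ^ 10 / 16) := Real.add_one_le_exp _
  -- `P¹⁴ e^{3C𝓛⁹(1+9log𝓛)} ≤ e^{𝓛¹⁰/8}`
  have hP14 : bigP D ^ 14 = Real.exp (14 * ell D ^ 9) := by
    rw [hP, ← Real.exp_nat_mul]; norm_num
  have hmid : bigP D ^ 14 * Real.exp (3 * C * ell D ^ 9 * (1 + 9 * Real.log (ell D))) ≤
      Real.exp (ell D ^ 10 / 8) := by
    rw [hP14, ← Real.exp_add, Real.exp_le_exp]
    have : 14 * ell D ^ 9 + 3 * C * ell D ^ 9 * (1 + 9 * Real.log (ell D)) =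
        (14 + 3 * C) * ell D ^ 9 + 27 * C * ell D ^ 9 * Real.log (ell D) := by ring
    rw [this]; exact hgrowth
  have hfinal : 4 * bigP D ^ 2 * Mval ≤ 1 * Real.exp (-(1 / 16) * ell D ^ 10) := by
    have e : 4 * bigP D ^ 2 * Mval = (4 * K * B ^ 2) *
        (bigP D ^ 14 * Real.exp (3 * C * ell D ^ 9 * (1 + 9 * Real.log (ell D)))) *
        Real.exp (-(ell D ^ 10) / 4) := by
      rw [hMval]; ring
    rw [e]
    have h1 := mul_le_mul hconst hmid (by positivity) (Real.exp_pos _).le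
    have h2 := mul_le_mul_of_nonneg_right h1 (Real.exp_pos (-(ell D ^ 10) / 4)).le
    refine h2.trans (le_of_eq ?_)
    rw [← Real.exp_add, ← Real.exp_add, one_mul]
    congr 1; ring
  exact hfinal

end Assembly

end Literature.NumberTheory.LFunctions.Zhang2022.Step8u016

end
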